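import Summits.KontsevichZagierPeriods.KontsevichZagierPeriods.Theorems.BetaCancellation.Negative.LoadBearing
import Literature.NumberTheory.Transcendental.KZMellinFibres
import Literature.NumberTheory.Transcendental.KZLogCalculusProofs
import Literature.NumberTheory.Transcendental.KZDominatedFamilyRelations

/-!
# `BetaCancellation` (stmt-KontsevichZagierPeriods-13633), line `dirichlet-companion-to-pi` — stub `stub_betaTranslation`

The two-term contiguity relation of the Beta function, `(a+b)·B(a,b+1) = b·B(a,b)`, realised
INSIDE the Kontsevich–Zagier calculus of moves: for `0 < a, b ∈ ℚ` and representations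
`ρ = [(0,1), (a+b) x^{a-1}(1-x)^b]`, `ρ' = [(0,1), b x^{a-1}(1-x)^{b-1}]` we prove `KZ.Equivalent ρ ρ'`
by three moves:

* `exists_rep_mem_relations_of_hasDerivAt` — `[(0,1), F'] ∈ KZ.relations` whenever `F` is
  continuous on `[0,1]`, `ℚ`-semialgebraic on `(0,1)`, vanishes at both end points and has the
  (`ℚ`-semialgebraic, integrable) derivative `F'` on `(0,1)`: ONE Newton–Leibniz move in dimension
  `0 + 1` from the point (`[[0,1], F'] − [pt, F(1) − F(0)]`, the band integrand patched by `0` at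
  the two boundary points), `[pt, 0] ∈ relations`, and the null boundary is dropped
  (`KZ.IntegralRep.of_sub_of_restrict_mem_relations`);
* applied to the primitive `F(t) = t^a (1-t)^b`, whose derivative on `(0,1)` is
  `F' = (a+b) t^{a-1}(1-t)^b − b t^{a-1}(1-t)^{b-1} = ρ.integrand − ρ'.integrand`
  (`exists_transRep`); semialgebraicity of these `rpow` integrands with RATIONAL exponents is
  `KZ.isSemialgebraicFunOn_mellinIntegrand` for the family `(X₀, 1 − X₀)`;
* ONE integrand-additivity move `[ρ] − [ρ'] − [(0,1), F']` (`stub_betaTranslation`).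

Pattern of `Negative/PiLinkMoves.lean` (`√` there, `rpow` here). Sorry-free; axioms ⊆ {propext,
Classical.choice, Quot.sound}.
-/

noncomputable section

set_option linter.dupNamespace false

namespace Summit.KontsevichZagierPeriods.KontsevichZagierPeriods.BetaCancellationLine

open MeasureTheory Set
open Literature.NumberTheory.Transcendental
open Literature.NumberTheory.Transcendental.KZ
open Literature.ModelTheory.ExponentialFields (IsSemialgebraic isSemialgebraic_univ)
open MvPolynomial (aeval X C)
open Summit.KontsevichZagierPeriods.KontsevichZagierPeriods.BetaCancellationNegative
open Literature.NumberTheory.Transcendental.KZreg (unitIoo isSemialgebraic_unitIoo volume_unitIoo)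

/-! ### §1 The closed band `[0,1] ⊆ ℝ¹` -/

/-- `[0,1] ⊆ ℝ¹` is `ℚ`-semialgebraic. [folklore] -/
theorem isSemialgebraic_setOf_unitIcc :
    IsSemialgebraic ℚ {x : Fin 1 → ℝ | 0 ≤ x 0 ∧ x 0 ≤ 1} := by
  have h1 := Literature.ModelTheory.ExponentialFields.isSemialgebraic_setOf_eval_le (k := ℚ) (R := ℝ)
    (0 : MvPolynomial (Fin 1) ℚ) (X 0)
  have h2 := Literature.ModelTheory.ExponentialFields.isSemialgebraic_setOf_eval_le (k := ℚ) (R := ℝ)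
    (X 0 : MvPolynomial (Fin 1) ℚ) 1
  have h := h1.inter h2
  simp only [map_zero, map_one, MvPolynomial.aeval_X] at h
  have hset : {x : Fin 1 → ℝ | 0 ≤ x 0 ∧ x 0 ≤ 1} = {x : Fin 1 → ℝ | 0 ≤ x 0} ∩ {x | x 0 ≤ 1} := by
    ext x
    simp
  rw [hset]
  exact h

/-- The points of `[0,1] ∖ (0,1) ⊆ ℝ¹` are the two boundary points. [folklore] -/
theorem apply_zero_eq_of_mem_unitIcc_diff_unitIoo {x : Fin 1 → ℝ}
    (hx : x ∈ {x : Fin 1 → ℝ | 0 ≤ x 0 ∧ x 0 ≤ 1} \ unitIoo) : x 0 = 0 ∨ x 0 = 1 := by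
  simp only [mem_sdiff, mem_setOf_eq, mem_unitIoo, mem_Ioo, not_and, not_lt] at hx
  obtain ⟨⟨h0, h1⟩, h⟩ := hx
  rcases h0.lt_or_eq with h0 | h0
  · exact Or.inr (le_antisymm h1 (h h0))
  · exact Or.inl h0.symm

/-- `[0,1] ∖ (0,1) ⊆ ℝ¹` is null (two hyperplanes). [folklore] -/
theorem volume_unitIcc_diff_unitIoo :
    volume ({x : Fin 1 → ℝ | 0 ≤ x 0 ∧ x 0 ≤ 1} \ unitIoo) = 0 := by
  refine measure_mono_null (fun x hx => ?_)
    (measure_union_null (volume_setOf_apply_eq_zero (0 : Fin 1) 0)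
      (volume_setOf_apply_eq_zero (0 : Fin 1) 1))
  simp only [mem_union, mem_setOf_eq]
  exact apply_zero_eq_of_mem_unitIcc_diff_unitIoo hx

/-! ### §2 `[(0,1), F'] ∈ relations` for a primitive vanishing at the end points -/

/-- **`∫₀¹ F' = 0` inside the calculus.** If `F : ℝ → ℝ` is continuous on `[0,1]`,
`ℚ`-semialgebraic on `(0,1)`, vanishes at `0` and at `1`, and has derivative `g` on `(0,1)` with `g`
`ℚ`-semialgebraic and integrable there, then some representation `[(0,1), g]` is a relation:
ONE Newton–Leibniz move in dimension `0 + 1` (band `[0,1]` over the point, integrand `g` patched by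
`0` on the boundary, primitive `F`, base `[pt, F(1) − F(0)] = [pt, 0] ∈ relations`), then the null
boundary `{0,1}` is dropped (`KZ.IntegralRep.of_sub_of_restrict_mem_relations`). [folklore] -/
theorem exists_rep_mem_relations_of_hasDerivAt {F g : ℝ → ℝ}
    (hFs : IsSemialgebraicFunOn ℚ unitIoo (fun x : Fin 1 → ℝ => F (x 0)))
    (hgs : IsSemialgebraicFunOn ℚ unitIoo (fun x : Fin 1 → ℝ => g (x 0)))
    (hF0 : F 0 = 0) (hF1 : F 1 = 0) (hFc : ContinuousOn F (Icc (0:ℝ) 1))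
    (hFg : ∀ t ∈ Ioo (0:ℝ) 1, HasDerivAt F (g t) t) (hg : IntegrableOn g (Ioo (0:ℝ) 1)) :
    ∃ D : IntegralRep 1, D.domain = unitIoo ∧
      EqOn D.integrand (fun x : Fin 1 → ℝ => g (x 0)) unitIoo ∧ of D ∈ relations := by
  classical
  -- the closed band and its boundary
  set I : Set (Fin 1 → ℝ) := {x | 0 ≤ x 0 ∧ x 0 ≤ 1} with hI
  have hIs : IsSemialgebraic ℚ I := isSemialgebraic_setOf_unitIcc
  have hsub : unitIoo ⊆ I := fun _ hx => ⟨hx.1.le, hx.2.le⟩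
  have hIU : I = unitIoo ∪ (I \ unitIoo) := (union_sdiff_cancel hsub).symm
  have hE : IsSemialgebraic ℚ (I \ unitIoo) := hIs.diff isSemialgebraic_unitIoo
  have h0E : IsSemialgebraicFunOn ℚ (I \ unitIoo) (fun _ => (0:ℝ)) :=
    (isSemialgebraicFunOn_aeval hE 0).congr fun x _ => by simp
  -- the band integrand: `g` on `(0,1)`, patched by `0` on the boundary
  set G : (Fin 1 → ℝ) → ℝ := fun x => if x 0 ∈ Ioo (0:ℝ) 1 then g (x 0) else 0 with hG
  have hGeq : ∀ x ∈ unitIoo, G x = g (x 0) := fun x hx => if_pos hx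
  have hGs : IsSemialgebraicFunOn ℚ I G := by
    rw [hIU]
    refine IsSemialgebraicFunOn.union hgs h0E hGeq (fun x hx => ?_)
    rcases apply_zero_eq_of_mem_unitIcc_diff_unitIoo hx with h | h <;> simp [hG, h]
  have hFI : IsSemialgebraicFunOn ℚ I (fun x : Fin 1 → ℝ => F (x 0)) := by
    rw [hIU]
    refine IsSemialgebraicFunOn.union hFs h0E (fun _ _ => rfl) (fun x hx => ?_)
    rcases apply_zero_eq_of_mem_unitIcc_diff_unitIoo hx with h | h
    · simp only [h, hF0]
    · simp only [h, hF1]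
  have hGi : IntegrableOn G I := by
    have hmeas : MeasurableSet unitIoo :=
      Literature.ModelTheory.ExponentialFields.IsSemialgebraic.measurableSet_holds
        isSemialgebraic_unitIoo
    have h1 : IntegrableOn (fun x : Fin 1 → ℝ => g (x 0)) unitIoo :=
      integrableOn_comp_apply_zero_iff.2 hg
    have h2 : IntegrableOn G unitIoo := h1.congr_fun (fun x hx => (hGeq x hx).symm) hmeas
    refine h2.congr_set_ae (ae_eq_set.2 ⟨volume_unitIcc_diff_unitIoo, ?_⟩)
    exact measure_mono_null (fun x hx => (hx.2 (hsub hx.1)).elim) measure_empty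
  -- the band representation `[[0,1], G]` and the point `[pt, 0]`
  obtain ⟨B, hBd, hBi⟩ : ∃ B : IntegralRep 1, B.domain = I ∧ B.integrand = G :=
    ⟨⟨I, G, hIs, hGs, hGi⟩, rfl, rfl⟩
  obtain ⟨P, hPd, hPi⟩ : ∃ P : IntegralRep 0, P.domain = univ ∧ P.integrand = 0 :=
    exists_zeroRep isSemialgebraic_univ
  have hP : of P ∈ relations := of_mem_relations_of_eqOn_zero P (by rw [hPi]; exact fun _ _ => rfl)
  have hsnoc : ∀ (x : Fin 0 → ℝ) (t : ℝ), (Fin.snoc x t : Fin 1 → ℝ) 0 = t := fun x t => by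
    rw [← Fin.last_zero, Fin.snoc_last]
  -- ONE Newton–Leibniz move: `[B] − [P] ∈ newtonLeibnizRel`
  have hNL : of B - of P ∈ newtonLeibnizRel := by
    refine ⟨0, B, P, fun _ => (0:ℝ), fun _ => (1:ℝ), fun z => F (z 0), hBd ▸ hFI, ?_, ?_,
      fun _ _ => zero_le_one, ?_, ?_, ?_, ?_, rfl⟩
    · rw [hPd]
      exact (isSemialgebraicFunOn_aeval isSemialgebraic_univ (0 : MvPolynomial (Fin 0) ℚ)).congr
        fun x _ => by simp
    · rw [hPd]
      exact (isSemialgebraicFunOn_aeval isSemialgebraic_univ (1 : MvPolynomial (Fin 0) ℚ)).congr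
        fun x _ => by simp
    · rw [hBd, hPd, hI]
      ext z
      simp only [mem_setOf_eq, mem_univ, true_and, Fin.last_zero]
    · intro x _
      simp only [hsnoc]
      exact hFc
    · intro x _ t ht
      have ht' : t ∈ Ioo (0:ℝ) 1 := ht
      simp only [hsnoc, hBi, hG]
      rw [if_pos ht']
      exact hFg t ht'
    · intro x _
      simp only [hPi, Pi.zero_apply, hsnoc, hF0, hF1, sub_self]
  -- `[B] ∈ relations`, drop the null boundary
  have hB : of B ∈ relations := by
    have := relations.add_mem (newtonLeibnizRel_subset_relations hNL) hP
    simpa using this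
  have hEr : unitIoo ⊆ B.domain := by rw [hBd]; exact hsub
  have hvol : volume (B.domain \ unitIoo) = 0 := by rw [hBd]; exact volume_unitIcc_diff_unitIoo
  have hBr := B.of_sub_of_restrict_mem_relations isSemialgebraic_unitIoo hEr hvol
  refine ⟨B.restrict unitIoo isSemialgebraic_unitIoo hEr, rfl, fun x hx => ?_, ?_⟩
  · rw [IntegralRep.integrand_restrict, hBi]
    exact hGeq x hx
  · have := relations.sub_mem hB hBr
    simpa using this

/-! ### §3 The primitive `t^a (1-t)^b` and its derivative -/

/-- `t ↦ t^a (1-t)^b` is continuous for `a, b ≥ 0`. [folklore] -/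
theorem continuous_rpow_mul_one_sub_rpow {a b : ℚ} (ha : 0 < a) (hb : 0 < b) :
    Continuous fun t : ℝ => t ^ (a:ℝ) * (1 - t) ^ (b:ℝ) := by
  have h1 : Continuous fun t : ℝ => t ^ (a:ℝ) :=
    Real.continuous_rpow_const (by exact_mod_cast ha.le)
  have h2 : Continuous fun t : ℝ => (1 - t) ^ (b:ℝ) :=
    (Real.continuous_rpow_const (by exact_mod_cast hb.le)).comp (continuous_const.sub continuous_id)
  exact h1.mul h2

/-- `d/dt (t^a (1-t)^b) = (a+b) t^{a-1}(1-t)^b − b t^{a-1}(1-t)^{b-1}` on `(0,1)`: the product rule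
gives `a t^{a-1}(1-t)^b − b t^a (1-t)^{b-1}`, and `t^a = t^{a-1}·t`, `(1-t)^b = (1-t)^{b-1}·(1-t)`.
[folklore] -/
theorem hasDerivAt_rpow_mul_one_sub_rpow (a b : ℚ) {t : ℝ} (ht : t ∈ Ioo (0:ℝ) 1) :
    HasDerivAt (fun s : ℝ => s ^ (a:ℝ) * (1 - s) ^ (b:ℝ))
      (((a:ℝ) + b) * (t ^ ((a:ℝ) - 1) * (1 - t) ^ (b:ℝ)) -
        (b:ℝ) * (t ^ ((a:ℝ) - 1) * (1 - t) ^ ((b:ℝ) - 1))) t := by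
  have ht0 : t ≠ 0 := ht.1.ne'
  have ht1 : 1 - t ≠ 0 := (sub_pos.2 ht.2).ne'
  have h1 : HasDerivAt (fun s : ℝ => s ^ (a:ℝ)) ((a:ℝ) * t ^ ((a:ℝ) - 1)) t :=
    Real.hasDerivAt_rpow_const (Or.inl ht0)
  have h2 : HasDerivAt (fun s : ℝ => (1 - s) ^ (b:ℝ)) ((-1) * (b:ℝ) * (1 - t) ^ ((b:ℝ) - 1)) t :=
    ((hasDerivAt_id' t).const_sub 1).rpow_const (Or.inl ht1)
  refine (h1.mul h2).congr_deriv ?_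
  have e1 : t ^ (a:ℝ) = t ^ ((a:ℝ) - 1) * t := by
    rw [Real.rpow_sub_one ht0, div_mul_cancel₀ _ ht0]
  have e2 : (1 - t) ^ (b:ℝ) = (1 - t) ^ ((b:ℝ) - 1) * (1 - t) := by
    rw [Real.rpow_sub_one ht1, div_mul_cancel₀ _ ht1]
  rw [e1, e2]
  ring

/-- The derivative is integrable on `(0,1)`: it is `(a+b)·k_{a,b+1} − b·k_{a,b}` for the Beta
kernels `k_{a,b}(t) = t^{a-1}(1-t)^{b-1}`, integrable for positive parameters
(`integrableOn_betaKernel_and_integral_eq`). [folklore] -/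
theorem integrableOn_transDeriv {a b : ℚ} (ha : 0 < a) (hb : 0 < b) :
    IntegrableOn (fun t : ℝ => ((a:ℝ) + b) * (t ^ ((a:ℝ) - 1) * (1 - t) ^ (b:ℝ)) -
      (b:ℝ) * (t ^ ((a:ℝ) - 1) * (1 - t) ^ ((b:ℝ) - 1))) (Ioo (0:ℝ) 1) := by
  have hb1 : 0 < b + 1 := by positivity
  have h1 : IntegrableOn (fun t => ((a:ℝ) + b) * betaKernel a (b + 1) t - (b:ℝ) * betaKernel a b t)
      (Ioo (0:ℝ) 1) :=
    ((integrableOn_betaKernel_and_integral_eq ha hb1).1.const_mul ((a:ℝ) + b)).sub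
      ((integrableOn_betaKernel_and_integral_eq ha hb).1.const_mul (b:ℝ))
  refine IntegrableOn.congr_fun h1 (fun t _ => ?_) measurableSet_Ioo
  simp only [betaKernel, Rat.cast_add, Rat.cast_one, add_sub_cancel_right]

/-! ### §4 Semialgebraicity of the `rpow` integrands (rational exponents) -/

/-- `κ · x₀^{e₀} (1-x₀)^{e₁}` (rational `κ, e₀, e₁`) is `ℚ`-semialgebraic on `(0,1)`: it is the
Euler–Mellin integrand of the family `(X₀, 1 − X₀)` (`KZ.isSemialgebraicFunOn_mellinIntegrand`).
[folklore] -/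
theorem isSemialgebraicFunOn_rpow_mul_one_sub_rpow (e₀ e₁ κ : ℚ) :
    IsSemialgebraicFunOn ℚ unitIoo
      (fun x : Fin 1 → ℝ => (κ:ℝ) * ((x 0) ^ (e₀:ℝ) * (1 - x 0) ^ (e₁:ℝ))) := by
  have hpos : ∀ x ∈ unitIoo, ∀ k : Fin 2,
      0 < aeval x ((![X 0, 1 - X 0] : Fin 2 → MvPolynomial (Fin 1) ℚ) k) := by
    intro x hx k
    simp only [mem_unitIoo, mem_Ioo] at hx
    fin_cases k <;> simp [hx.1, hx.2]
  refine (isSemialgebraicFunOn_mellinIntegrand isSemialgebraic_unitIoo ![X 0, 1 - X 0] ![e₀, e₁] κ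
    hpos).congr fun x _ => ?_
  simp [mellinIntegrand, Fin.prod_univ_two]

/-- The derivative `(a+b) x₀^{a-1}(1-x₀)^b − b x₀^{a-1}(1-x₀)^{b-1}` is `ℚ`-semialgebraic on
`(0,1)`. [folklore] -/
theorem isSemialgebraicFunOn_transDeriv (a b : ℚ) :
    IsSemialgebraicFunOn ℚ unitIoo (fun x : Fin 1 → ℝ =>
      ((a:ℝ) + b) * ((x 0) ^ ((a:ℝ) - 1) * (1 - x 0) ^ (b:ℝ)) -
        (b:ℝ) * ((x 0) ^ ((a:ℝ) - 1) * (1 - x 0) ^ ((b:ℝ) - 1))) := by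
  have h1 := isSemialgebraicFunOn_rpow_mul_one_sub_rpow (a - 1) b (a + b)
  have h2 := isSemialgebraicFunOn_rpow_mul_one_sub_rpow (a - 1) (b - 1) b
  refine (IsSemialgebraicFunOn.sub_holds h1 h2).congr fun x _ => ?_
  simp only [Pi.sub_apply, Rat.cast_sub, Rat.cast_add, Rat.cast_one]

/-- The primitive `x₀^a (1-x₀)^b` is `ℚ`-semialgebraic on `(0,1)`. [folklore] -/
theorem isSemialgebraicFunOn_transPrim (a b : ℚ) :
    IsSemialgebraicFunOn ℚ unitIoo (fun x : Fin 1 → ℝ => (x 0) ^ (a:ℝ) * (1 - x 0) ^ (b:ℝ)) :=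
  (isSemialgebraicFunOn_rpow_mul_one_sub_rpow a b 1).congr fun x _ => by simp

/-! ### §5 The moves -/

/-- **`[(0,1), (a+b) t^{a-1}(1-t)^b − b t^{a-1}(1-t)^{b-1}] ∈ relations`** for `0 < a, b`: the
Newton–Leibniz move with primitive `t^a (1-t)^b` (`exists_rep_mem_relations_of_hasDerivAt`).
[folklore] -/
theorem exists_transRep {a b : ℚ} (ha : 0 < a) (hb : 0 < b) :
    ∃ D : IntegralRep 1, D.domain = unitIoo ∧
      EqOn D.integrand (fun x : Fin 1 → ℝ =>
        ((a:ℝ) + b) * ((x 0) ^ ((a:ℝ) - 1) * (1 - x 0) ^ (b:ℝ)) -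
          (b:ℝ) * ((x 0) ^ ((a:ℝ) - 1) * (1 - x 0) ^ ((b:ℝ) - 1))) unitIoo ∧
      of D ∈ relations := by
  have ha' : (a:ℝ) ≠ 0 := by exact_mod_cast ha.ne'
  have hb' : (b:ℝ) ≠ 0 := by exact_mod_cast hb.ne'
  exact exists_rep_mem_relations_of_hasDerivAt
    (F := fun t : ℝ => t ^ (a:ℝ) * (1 - t) ^ (b:ℝ))
    (g := fun t : ℝ => ((a:ℝ) + b) * (t ^ ((a:ℝ) - 1) * (1 - t) ^ (b:ℝ)) -
      (b:ℝ) * (t ^ ((a:ℝ) - 1) * (1 - t) ^ ((b:ℝ) - 1)))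
    (isSemialgebraicFunOn_transPrim a b) (isSemialgebraicFunOn_transDeriv a b)
    (by simp [Real.zero_rpow ha']) (by simp [Real.zero_rpow hb'])
    (continuous_rpow_mul_one_sub_rpow ha hb).continuousOn
    (fun t ht => hasDerivAt_rpow_mul_one_sub_rpow a b ht) (integrableOn_transDeriv ha hb)

/-- **Beta translation inside the calculus**: `(a+b)·[β(a,b+1)] ∼ b·[β(a,b)]`, i.e. for
`ρ = [(0,1), (a+b) x^{a-1}(1-x)^b]` and `ρ' = [(0,1), b x^{a-1}(1-x)^{b-1}]`, `ρ ∼ ρ'`: ONE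
integrand-additivity move `[ρ] − [ρ'] − [(0,1), F']` on top of `[(0,1), F'] ∈ relations`
(`exists_transRep`: one Newton–Leibniz move with primitive `F = t^a(1-t)^b`, a null boundary).
[folklore] -/
theorem stub_betaTranslation : ∀ (a b : ℚ), 0 < a → 0 < b →
    ∀ (ρ ρ' : Literature.NumberTheory.Transcendental.KZ.IntegralRep 1),
    ρ.domain = {x | x 0 ∈ Set.Ioo (0:ℝ) 1} →
    Set.EqOn ρ.integrand (fun x => ((a:ℝ) + b) * ((x 0) ^ ((a:ℝ) - 1) * (1 - x 0) ^ (b:ℝ))) ρ.domain →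
    ρ'.domain = {x | x 0 ∈ Set.Ioo (0:ℝ) 1} →
    Set.EqOn ρ'.integrand (fun x => (b:ℝ) * ((x 0) ^ ((a:ℝ) - 1) * (1 - x 0) ^ ((b:ℝ) - 1))) ρ'.domain →
    Literature.NumberTheory.Transcendental.KZ.Equivalent ρ ρ' := by
  intro a b ha hb ρ ρ' hρ hρi hρ' hρ'i
  obtain ⟨D, hDd, hDi, hD⟩ := exists_transRep ha hb
  have h1 : of ρ - of ρ' - of D ∈ integrandAddRel := by
    refine ⟨1, ρ, ρ', D, hρ'.trans hρ.symm, ?_, fun x hx => ?_, rfl⟩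
    · rw [hDd, hρ]
      rfl
    · have hx' : x ∈ unitIoo := by rw [hρ] at hx; exact hx
      have hxρ' : x ∈ ρ'.domain := by rw [hρ']; exact hx'
      simp only [Pi.add_apply, hρi hx, hρ'i hxρ', hDi hx']
      ring
  have := relations.add_mem (integrandAddRel_subset_relations h1) hD
  simpa [Equivalent] using this

end Summit.KontsevichZagierPeriods.KontsevichZagierPeriods.BetaCancellationLine
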